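import Literature.Topology.FourManifolds.DehnSurgery
import Literature.Topology.FourManifolds.GluckTwistFibre
import Literature.Topology.FourManifolds.GluingUniqueness
import Literature.Topology.FourManifolds.KnotGroupTubular
import HarnessLib

/-!
# Fibre twists of tubular neighbourhoods of a link, pushed into `S³`

Topic `Literature/Topology/FourManifolds`; a device for the uniqueness of Dehn surgery on a framed
link (`Literature.Topology.FourManifolds.FramedLink.IsSurgery.nonempty_diffeomorph`, `KirbyMovesSurgery.lean`, leaf (U) of the
decomposition of Kirby's theorem recorded there). Everything in this file is proved.

Given pairwise disjoint oriented tubular neighbourhoods `νᵢ : S¹ × ℝ² ↪ S³` of the components of a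
link and smooth angle functions `βᵢ : S¹ → ℝ`, there is a diffeomorphism `ρ` of `S³` with
`ρ (νᵢ (x, w)) = νᵢ (x, R(βᵢ x) w)` for `‖w‖ ≤ 1` (rotation of the normal fibre over `x` by the angle
`βᵢ x`), equal to the identity off `⋃ᵢ νᵢ(S¹ × ℝ²)` (`Literature.Topology.FourManifolds.Link.exists_diffeomorph_fibreTwist`). It is
obtained by pushing the **fibre twist** `(x, w) ↦ (x, R(χ(‖w‖²) βᵢ x) w)` of `S¹ × ℝ²` (cut off
radially: the identity for `‖w‖ ≥ 2`) forward along each `νᵢ` and extending by the identity — the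
extension by the identity of a compactly supported diffeomorphism of an open subset (Hirsch,
*Differential Topology* (1976), Ch. 8 §1; the same device as
`Literature.Topology.FourManifolds.TwoKnot.TubularNbhd.pushforwardDiffeo` of `GluckTwistLocality.lean` for 2-knots in `S⁴`, whose
construction is repeated here for knots in `S³`).

In the proof of the uniqueness of surgery this untwists the fibre rotation left over by the
uniqueness of tubular neighbourhoods once the equality of framings has shown that the rotation
field `S¹ → SO(2)` has degree zero, i.e. lifts to an angle function.

* `Literature.circleFibreTwistFun β`, `Literature.circleFibreTwist β hβ` — the fibre twist of `S¹ × ℝ²`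
  (`GluckTwistFibre.lean`'s `fibreTwist` with base `S¹` instead of `S²`);
* `Literature.Topology.FourManifolds.Knot.TubularNbhd.pushforward`, `…pushforwardDiffeo` — `ν ∘ Θ ∘ ν⁻¹` extended by the
  identity, for a diffeomorphism `Θ` of `S¹ × ℝ²` equal to the identity off a tube `S¹ × B̄_R`;
* `Literature.Topology.FourManifolds.Link.exists_diffeomorph_fibreTwist` — the simultaneous version for the pairwise disjoint
  tubular neighbourhoods of the components of a link (composition over the components).

## References

* M. W. Hirsch, *Differential Topology*, GTM 33, Springer (1976), Ch. 8 §1 (extension of compactly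
  supported diffeotopies of open subsets by the identity). [cite: Hirsch1976, Ch. 8 §1]
* D. Rolfsen, *Knots and Links* (1976), §9.F (the surgered manifold depends only on the framed
  link). [cite: Rolfsen1976, §9.F]

## Design notes

* `rotPlane`, `tubeCutoff`, `quarterTurn` are the tree's (`GluckTwistFibre.lean`); smoothness across
  the seam of the push-forward is `Literature.Topology.FourManifolds.contMDiffAt_of_comp_isImmersionAt` (`GluingUniqueness.lean`)
  and openness of `ν` is `Knot.TubularNbhd.isOpenMap` (`KnotGroupTubular.lean`).
* No declaration in this file uses `sorry`.
-/

open scoped Manifold ContDiff Topology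
open Function Set Metric

noncomputable section

namespace Literature.Topology.FourManifolds

/-- Local notation: `𝔼 n` is the model Euclidean space `EuclideanSpace ℝ (Fin n)`. -/
local notation "𝔼 " n:arg => EuclideanSpace ℝ (Fin n)

/-- Local notation: `𝕊 n` is the unit sphere in `EuclideanSpace ℝ (Fin (n + 1))`. -/
local notation "𝕊 " n:arg => (Metric.sphere (0 : EuclideanSpace ℝ (Fin (n + 1))) 1)

/-! ### The fibre twist of `S¹ × ℝ²` by an angle function -/

section FibreTwist

variable (β : (𝕊 1) → ℝ)

/-- The **fibre twist** of `S¹ × ℝ²` by the angle function `β : S¹ → ℝ`, cut off in the fibre: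
`(x, w) ↦ (x, R(χ(‖w‖²) β x) w)`; it rotates the fibre over `x` by `β x` inside the unit tube and
is the identity outside the tube of radius `2` (the `S¹`-base version of `Literature.Topology.FourManifolds.fibreTwistFun`).
[folklore] -/
def circleFibreTwistFun (p : (𝕊 1) × 𝔼 2) : (𝕊 1) × 𝔼 2 :=
  (p.1, rotPlane (tubeCutoff (‖p.2‖ ^ 2) * β p.1) p.2)

/-- First component of the fibre twist. [folklore] -/
@[simp]
theorem circleFibreTwistFun_fst (p : (𝕊 1) × 𝔼 2) : (circleFibreTwistFun β p).1 = p.1 := rfl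

/-- Second component of the fibre twist. [folklore] -/
theorem circleFibreTwistFun_snd (p : (𝕊 1) × 𝔼 2) :
    (circleFibreTwistFun β p).2 = rotPlane (tubeCutoff (‖p.2‖ ^ 2) * β p.1) p.2 := rfl

/-- The fibre twist preserves the fibre norm. [folklore] -/
@[simp]
theorem norm_circleFibreTwistFun_snd (p : (𝕊 1) × 𝔼 2) :
    ‖(circleFibreTwistFun β p).2‖ = ‖p.2‖ := by
  simp [circleFibreTwistFun_snd]

/-- The fibre twist by `-β` undoes the fibre twist by `β`. [folklore] -/
theorem circleFibreTwistFun_neg_circleFibreTwistFun (p : (𝕊 1) × 𝔼 2) :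
    circleFibreTwistFun (fun x => -β x) (circleFibreTwistFun β p) = p := by
  obtain ⟨x, w⟩ := p
  simp only [circleFibreTwistFun, norm_rotPlane, mul_neg, rotPlane_neg_rotPlane]

/-- Outside the tube of radius `2` the fibre twist is the identity. [folklore] -/
theorem circleFibreTwistFun_of_two_le {p : (𝕊 1) × 𝔼 2} (h : 2 ≤ ‖p.2‖) :
    circleFibreTwistFun β p = p := by
  obtain ⟨x, w⟩ := p
  simp only [circleFibreTwistFun, tubeCutoff_norm_sq_of_two_le_norm h, zero_mul, rotPlane_zero]

/-- Inside the unit tube the fibre twist rotates the fibre over `x` by `β x`. [folklore] -/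
theorem circleFibreTwistFun_of_norm_le_one {p : (𝕊 1) × 𝔼 2} (h : ‖p.2‖ ≤ 1) :
    circleFibreTwistFun β p = (p.1, rotPlane (β p.1) p.2) := by
  obtain ⟨x, w⟩ := p
  simp only [circleFibreTwistFun, tubeCutoff_norm_sq_of_norm_le_one h, one_mul]

/-- The fibre twist fixes the zero section. [folklore] -/
@[simp]
theorem circleFibreTwistFun_zero (x : 𝕊 1) : circleFibreTwistFun β (x, 0) = (x, 0) := by
  simp [circleFibreTwistFun]

variable {β}

/-- The cut-off angle `(x, w) ↦ χ(‖w‖²) β x` is smooth for smooth `β`. [folklore] -/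
theorem contMDiff_tubeCutoff_mul_circle (hβ : ContMDiff (𝓡 1) 𝓘(ℝ, ℝ) ∞ β) :
    ContMDiff ((𝓡 1).prod 𝓘(ℝ, 𝔼 2)) 𝓘(ℝ, ℝ) ∞ fun p : (𝕊 1) × 𝔼 2 => tubeCutoff (‖p.2‖ ^ 2) * β p.1 :=
  (contDiff_tubeCutoff_norm_sq.contMDiff.comp contMDiff_snd).smul (hβ.comp contMDiff_fst)

/-- The second component of the fibre twist is smooth for smooth `β`. [folklore] -/
theorem contMDiff_circleFibreTwistFun_snd (hβ : ContMDiff (𝓡 1) 𝓘(ℝ, ℝ) ∞ β) :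
    ContMDiff ((𝓡 1).prod 𝓘(ℝ, 𝔼 2)) 𝓘(ℝ, 𝔼 2) ∞
      fun p : (𝕊 1) × 𝔼 2 => rotPlane (tubeCutoff (‖p.2‖ ^ 2) * β p.1) p.2 := by
  have ha := contMDiff_tubeCutoff_mul_circle hβ
  have hc : ContMDiff ((𝓡 1).prod 𝓘(ℝ, 𝔼 2)) 𝓘(ℝ, ℝ) ∞
      fun p : (𝕊 1) × 𝔼 2 => Real.cos (tubeCutoff (‖p.2‖ ^ 2) * β p.1) :=
    Real.contDiff_cos.contMDiff.comp ha
  have hs : ContMDiff ((𝓡 1).prod 𝓘(ℝ, 𝔼 2)) 𝓘(ℝ, ℝ) ∞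
      fun p : (𝕊 1) × 𝔼 2 => Real.sin (tubeCutoff (‖p.2‖ ^ 2) * β p.1) :=
    Real.contDiff_sin.contMDiff.comp ha
  have hJ : ContMDiff ((𝓡 1).prod 𝓘(ℝ, 𝔼 2)) 𝓘(ℝ, 𝔼 2) ∞ fun p : (𝕊 1) × 𝔼 2 => quarterTurn p.2 :=
    contDiff_quarterTurn.contMDiff.comp contMDiff_snd
  exact ((hc.smul contMDiff_snd).add (hs.smul hJ)).congr fun p => rotPlane_eq_smul_add _ _

/-- The fibre twist by a smooth angle function is smooth. [folklore] -/
theorem contMDiff_circleFibreTwistFun (hβ : ContMDiff (𝓡 1) 𝓘(ℝ, ℝ) ∞ β) :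
    ContMDiff ((𝓡 1).prod 𝓘(ℝ, 𝔼 2)) ((𝓡 1).prod 𝓘(ℝ, 𝔼 2)) ∞ (circleFibreTwistFun β) :=
  contMDiff_fst.prodMk (contMDiff_circleFibreTwistFun_snd hβ)

/-- The **fibre twist diffeomorphism** of `S¹ × ℝ²` by a smooth angle function `β` (inverse: the
fibre twist by `-β`); the identity outside the tube of radius `2`, rotation of the fibre over `x`
by `β x` inside the unit tube. [folklore] -/
def circleFibreTwist (β : (𝕊 1) → ℝ) (hβ : ContMDiff (𝓡 1) 𝓘(ℝ, ℝ) ∞ β) :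
    ((𝕊 1) × 𝔼 2) ≃ₘ⟮((𝓡 1).prod 𝓘(ℝ, 𝔼 2)), ((𝓡 1).prod 𝓘(ℝ, 𝔼 2))⟯ ((𝕊 1) × 𝔼 2) where
  toFun := circleFibreTwistFun β
  invFun := circleFibreTwistFun fun x => -β x
  left_inv := circleFibreTwistFun_neg_circleFibreTwistFun β
  right_inv p := by
    have h := circleFibreTwistFun_neg_circleFibreTwistFun (fun x => -β x) p
    simpa only [neg_neg] using h
  contMDiff_toFun := contMDiff_circleFibreTwistFun (β := β) hβ
  contMDiff_invFun := contMDiff_circleFibreTwistFun (β := fun x => -β x) hβ.neg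

/-- The fibre twist diffeomorphism as a function. [folklore] -/
@[simp]
theorem coe_circleFibreTwist (hβ : ContMDiff (𝓡 1) 𝓘(ℝ, ℝ) ∞ β) :
    ⇑(circleFibreTwist β hβ) = circleFibreTwistFun β := rfl

end FibreTwist

/-! ### Pushing a fibrewise compactly supported diffeomorphism of the tube into `S³` -/

namespace Knot.TubularNbhd

variable {K : 𝕊 1 → 𝕊 3} (ν : Knot.TubularNbhd K)

/-- The **push-forward along `ν`** of a self-map `Θ` of `S¹ × ℝ²`, extended by the identity
outside the range of `ν`: `ν p ↦ ν (Θ p)`, `y ↦ y` for `y ∉ ν(S¹ × ℝ²)` (knot version of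
`Literature.Topology.FourManifolds.TwoKnot.TubularNbhd.pushforward`). Hirsch (1976), Ch. 8 §1. [folklore] -/
def pushforward (Θ : (𝕊 1) × 𝔼 2 → (𝕊 1) × 𝔼 2) : (𝕊 3) → 𝕊 3 :=
  Function.extend ν (ν ∘ Θ) id

/-- The push-forward on the range of `ν`. [folklore] -/
@[simp]
theorem pushforward_apply (Θ : (𝕊 1) × 𝔼 2 → (𝕊 1) × 𝔼 2) (p : (𝕊 1) × 𝔼 2) :
    ν.pushforward Θ (ν p) = ν (Θ p) :=
  ν.injective.extend_apply _ _ p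

/-- The push-forward off the range of `ν` is the identity. [folklore] -/
theorem pushforward_of_not_mem (Θ : (𝕊 1) × 𝔼 2 → (𝕊 1) × 𝔼 2) {y : 𝕊 3}
    (hy : y ∉ range ν) : ν.pushforward Θ y = y := by
  rw [pushforward, extend_apply' _ _ _ (by simpa only [mem_range] using hy)]
  rfl

/-- Push-forwards compose. [folklore] -/
theorem pushforward_pushforward (Θ Θ' : (𝕊 1) × 𝔼 2 → (𝕊 1) × 𝔼 2) (y : 𝕊 3) :
    ν.pushforward Θ (ν.pushforward Θ' y) = ν.pushforward (Θ ∘ Θ') y := by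
  by_cases hy : y ∈ range ν
  · obtain ⟨p, rfl⟩ := hy
    simp
  · rw [ν.pushforward_of_not_mem Θ' hy, ν.pushforward_of_not_mem Θ hy,
      ν.pushforward_of_not_mem _ hy]

/-- The push-forward of the identity is the identity. [folklore] -/
theorem pushforward_id (y : 𝕊 3) : ν.pushforward id y = y := by
  by_cases hy : y ∈ range ν
  · obtain ⟨p, rfl⟩ := hy
    simp
  · exact ν.pushforward_of_not_mem _ hy

/-- Outside the image of the tube `S¹ × B̄_R` the push-forward of a map supported in that tube is
the identity. [folklore] -/
theorem pushforward_eq_self_of_not_mem_image {Θ : (𝕊 1) × 𝔼 2 → (𝕊 1) × 𝔼 2} {R : ℝ}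
    (hΘ : ∀ p : (𝕊 1) × 𝔼 2, R ≤ ‖p.2‖ → Θ p = p) {y : 𝕊 3}
    (hy : y ∉ ν '' (univ ×ˢ closedBall (0 : 𝔼 2) R)) : ν.pushforward Θ y = y := by
  by_cases hy' : y ∈ range ν
  · obtain ⟨p, rfl⟩ := hy'
    rw [pushforward_apply, hΘ p]
    by_contra hp
    exact hy ⟨p, ⟨mem_univ _, mem_closedBall_zero_iff.2 (not_le.1 hp).le⟩, rfl⟩
  · exact ν.pushforward_of_not_mem Θ hy'

/-- **Smoothness of the push-forward.** If `Θ` is smooth and is the identity outside the tube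
`S¹ × B̄_R`, then `ν.pushforward Θ` is smooth: at points `ν p` this is the descent of the
smoothness of `ν ∘ Θ` along the open immersion `ν` (`contMDiffAt_of_comp_isImmersionAt`), and on
the open complement of the compact set `ν (S¹ × B̄_R)` the map is the identity. [folklore] -/
theorem contMDiff_pushforward {Θ : (𝕊 1) × 𝔼 2 → (𝕊 1) × 𝔼 2}
    (hΘs : ContMDiff ((𝓡 1).prod 𝓘(ℝ, 𝔼 2)) ((𝓡 1).prod 𝓘(ℝ, 𝔼 2)) ∞ Θ) {R : ℝ} (hΘ : ∀ p : (𝕊 1) × 𝔼 2, R ≤ ‖p.2‖ → Θ p = p) :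
    ContMDiff (𝓡 3) (𝓡 3) ∞ (ν.pushforward Θ) := by
  intro y
  by_cases hy : y ∈ range ν
  · obtain ⟨p, rfl⟩ := hy
    exact contMDiffAt_of_comp_isImmersionAt
      (ν.isSmoothEmbedding_coe.isImmersion.isImmersionAt p) ν.isOpenMap
      ((ν.contMDiff.comp hΘs) p) (fun p' => ν.pushforward_apply Θ p')
  · have hC : IsClosed (ν '' (univ ×ˢ closedBall (0 : 𝔼 2) R)) :=
      ((isCompact_univ.prod (isCompact_closedBall _ _)).image ν.continuous).isClosed
    have hyC : y ∈ (ν '' (univ ×ˢ closedBall (0 : 𝔼 2) R))ᶜ := fun h =>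
      hy (image_subset_range _ _ h)
    refine contMDiffAt_id.congr_of_eventuallyEq ?_
    filter_upwards [hC.isOpen_compl.mem_nhds hyC] with z hz
    exact ν.pushforward_eq_self_of_not_mem_image hΘ hz

/-- **Extension by the identity of a fibrewise compactly supported diffeomorphism of the tube.**
For a diffeomorphism `Θ` of `S¹ × ℝ²` which is the identity outside `S¹ × B̄_R`, the push-forward
`ν p ↦ ν (Θ p)` (identity off the range of `ν`) is a diffeomorphism `ψ` of `S³` with
`ψ ∘ ν = ν ∘ Θ`. Hirsch, *Differential Topology* (1976), Ch. 8 §1. [cite: Hirsch1976, Ch. 8 §1] -/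
def pushforwardDiffeo (Θ : ((𝕊 1) × 𝔼 2) ≃ₘ⟮((𝓡 1).prod 𝓘(ℝ, 𝔼 2)), ((𝓡 1).prod 𝓘(ℝ, 𝔼 2))⟯ ((𝕊 1) × 𝔼 2)) {R : ℝ}
    (hΘ : ∀ p : (𝕊 1) × 𝔼 2, R ≤ ‖p.2‖ → Θ p = p) : (𝕊 3) ≃ₘ⟮𝓡 3, 𝓡 3⟯ (𝕊 3) where
  toFun := ν.pushforward Θ
  invFun := ν.pushforward Θ.symm
  left_inv y := by
    rw [pushforward_pushforward]
    convert ν.pushforward_id y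
    funext p
    simp
  right_inv y := by
    rw [pushforward_pushforward]
    convert ν.pushforward_id y
    funext p
    simp
  contMDiff_toFun := ν.contMDiff_pushforward Θ.contMDiff hΘ
  contMDiff_invFun := ν.contMDiff_pushforward Θ.symm.contMDiff fun p hp =>
    calc Θ.symm p = Θ.symm (Θ p) := by rw [hΘ p hp]
      _ = p := Θ.symm_apply_apply p

/-- The pushed-forward diffeomorphism intertwines `ν` and `ν ∘ Θ`. [folklore] -/
@[simp]
theorem pushforwardDiffeo_apply (Θ : ((𝕊 1) × 𝔼 2) ≃ₘ⟮((𝓡 1).prod 𝓘(ℝ, 𝔼 2)), ((𝓡 1).prod 𝓘(ℝ, 𝔼 2))⟯ ((𝕊 1) × 𝔼 2)) {R : ℝ}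
    (hΘ : ∀ p : (𝕊 1) × 𝔼 2, R ≤ ‖p.2‖ → Θ p = p) (p : (𝕊 1) × 𝔼 2) :
    ν.pushforwardDiffeo Θ hΘ (ν p) = ν (Θ p) :=
  ν.pushforward_apply Θ p

/-- Off the range of `ν` the pushed-forward diffeomorphism is the identity. [folklore] -/
theorem pushforwardDiffeo_of_not_mem (Θ : ((𝕊 1) × 𝔼 2) ≃ₘ⟮((𝓡 1).prod 𝓘(ℝ, 𝔼 2)), ((𝓡 1).prod 𝓘(ℝ, 𝔼 2))⟯ ((𝕊 1) × 𝔼 2)) {R : ℝ}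
    (hΘ : ∀ p : (𝕊 1) × 𝔼 2, R ≤ ‖p.2‖ → Θ p = p) {y : 𝕊 3} (hy : y ∉ range ν) :
    ν.pushforwardDiffeo Θ hΘ y = y :=
  ν.pushforward_of_not_mem Θ hy

end Knot.TubularNbhd

/-! ### Simultaneous fibre twists of the tubular neighbourhoods of a link -/

namespace Link

variable {ι : Type*} [Finite ι]

/-- The fibre twist of `S¹ × ℝ²` is the identity outside the tube of radius `2` (support form
consumed by `pushforwardDiffeo`). [folklore] -/
theorem circleFibreTwist_eq_self_of_le {β : (𝕊 1) → ℝ} (hβ : ContMDiff (𝓡 1) 𝓘(ℝ, ℝ) ∞ β)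
    (p : (𝕊 1) × 𝔼 2) (hp : 2 ≤ ‖p.2‖) : circleFibreTwist β hβ p = p :=
  circleFibreTwistFun_of_two_le β hp

/-- **Simultaneous fibre twists of the tubular neighbourhoods of a link, pushed into `S³`.** Let
`νᵢ : S¹ × ℝ² ↪ S³` be oriented tubular neighbourhoods of the components of a link with pairwise
disjoint images and `βᵢ : S¹ → ℝ` smooth angle functions. Then there is a diffeomorphism `ρ` of
`S³` with `ρ (νᵢ p) = νᵢ (circleFibreTwistFun βᵢ p)` for all `i`, `p` — in particular
`ρ (νᵢ (x, w)) = νᵢ (x, R(βᵢ x) w)` for `‖w‖ ≤ 1` and `ρ` fixes every component of the link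
pointwise — and `ρ = id` off `⋃ᵢ νᵢ(S¹ × ℝ²)`: the composite of the push-forwards
`Knot.TubularNbhd.pushforwardDiffeo (νᵢ) (circleFibreTwist βᵢ)`, which have pairwise disjoint
supports. Extension by the identity of compactly supported diffeomorphisms of open subsets,
Hirsch, *Differential Topology* (1976), Ch. 8 §1. [cite: Hirsch1976, Ch. 8 §1] -/
theorem exists_diffeomorph_fibreTwist (L : Link ι) (ν : ∀ i, Knot.TubularNbhd (L.component i))
    (hdisj : Pairwise fun i j ↦ Disjoint (range (ν i)) (range (ν j)))
    (β : ι → (𝕊 1) → ℝ) (hβ : ∀ i, ContMDiff (𝓡 1) 𝓘(ℝ, ℝ) ∞ (β i)) :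
    ∃ ρ : (𝕊 3) ≃ₘ⟮𝓡 3, 𝓡 3⟯ (𝕊 3),
      (∀ i p, ρ (ν i p) = ν i (circleFibreTwistFun (β i) p)) ∧
      (∀ y, y ∉ (⋃ i, range (ν i)) → ρ y = y) := by
  classical
  -- the single push-forwards
  set ψ : ∀ i, (𝕊 3) ≃ₘ⟮𝓡 3, 𝓡 3⟯ (𝕊 3) := fun i =>
    (ν i).pushforwardDiffeo (circleFibreTwist (β i) (hβ i))
      (circleFibreTwist_eq_self_of_le (hβ i)) with hψ
  have hψν : ∀ i p, ψ i (ν i p) = ν i (circleFibreTwistFun (β i) p) := fun i p =>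
    (ν i).pushforwardDiffeo_apply _ _ p
  have hψid : ∀ i y, y ∉ range (ν i) → ψ i y = y := fun i y hy =>
    (ν i).pushforwardDiffeo_of_not_mem _ _ hy
  have hνnot : ∀ {i j}, i ≠ j → ∀ p, ν j p ∉ range (ν i) := fun hij p h =>
    Set.disjoint_left.1 (hdisj hij) h (mem_range_self p)
  -- composition over a finite set of components
  have key : ∀ s : Finset ι, ∃ ρ : (𝕊 3) ≃ₘ⟮𝓡 3, 𝓡 3⟯ (𝕊 3),
      (∀ i ∈ s, ∀ p, ρ (ν i p) = ν i (circleFibreTwistFun (β i) p)) ∧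
      (∀ y, (∀ i ∈ s, y ∉ range (ν i)) → ρ y = y) := by
    intro s
    induction s using Finset.induction_on with
    | empty => exact ⟨Diffeomorph.refl _ _ _, by simp, fun y _ => rfl⟩
    | @insert j s hj ih =>
      obtain ⟨ρ, hρ, hρid⟩ := ih
      refine ⟨(ψ j).trans ρ, fun i hi p => ?_, fun y hy => ?_⟩
      · rw [Diffeomorph.coe_trans, comp_apply]
        rcases Finset.mem_insert.1 hi with rfl | hi
        · rw [hψν]
          exact hρid _ fun k hk => hνnot (ne_of_mem_of_not_mem hk hj) _
        · rw [hψid j _ (hνnot (ne_of_mem_of_not_mem hi hj).symm p)]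
          exact hρ i hi p
      · rw [Diffeomorph.coe_trans, comp_apply, hψid j y (hy j (Finset.mem_insert_self j s))]
        exact hρid y fun i hi => hy i (Finset.mem_insert_of_mem hi)
  haveI := Fintype.ofFinite ι
  obtain ⟨ρ, hρ, hρid⟩ := key Finset.univ
  refine ⟨ρ, fun i p => hρ i (Finset.mem_univ i) p, fun y hy => hρid y fun i _ h => hy ?_⟩
  exact mem_iUnion.2 ⟨i, h⟩

/-- The diffeomorphism of `exists_diffeomorph_fibreTwist` rotates the fibres of the unit tubes:
`ρ (νᵢ (x, w)) = νᵢ (x, R(βᵢ x) w)` for `‖w‖ ≤ 1`, and fixes the components of the link pointwise.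
[folklore] -/
theorem exists_diffeomorph_fibreTwist' (L : Link ι) (ν : ∀ i, Knot.TubularNbhd (L.component i))
    (hdisj : Pairwise fun i j ↦ Disjoint (range (ν i)) (range (ν j)))
    (β : ι → (𝕊 1) → ℝ) (hβ : ∀ i, ContMDiff (𝓡 1) 𝓘(ℝ, ℝ) ∞ (β i)) :
    ∃ ρ : (𝕊 3) ≃ₘ⟮𝓡 3, 𝓡 3⟯ (𝕊 3),
      (∀ i (x : 𝕊 1) (w : 𝔼 2), ‖w‖ ≤ 1 → ρ (ν i (x, w)) = ν i (x, rotPlane (β i x) w)) ∧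
      (∀ i x, ρ (L.component i x) = L.component i x) ∧
      (∀ y, y ∉ (⋃ i, range (ν i)) → ρ y = y) := by
  obtain ⟨ρ, hρ, hρid⟩ := exists_diffeomorph_fibreTwist L ν hdisj β hβ
  refine ⟨ρ, fun i x w hw => ?_, fun i x => ?_, hρid⟩
  · rw [hρ i (x, w), circleFibreTwistFun_of_norm_le_one (β i) (by exact hw)]
  · rw [← (ν i).coe_apply_zero x, hρ i (x, 0), circleFibreTwistFun_zero]

end Link

end Literature.Topology.FourManifolds
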